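import Summits.BirchSwinnertonDyer.Rank1Residual.Additive.CuspDivisionPolynomialSecondOrder
import Summits.BirchSwinnertonDyer.Rank1Residual.Additive.LocalTorsionAdditiveFiveSeven
import Literature.NumberTheory.EllipticCurves.BinaryQuarticGoodReductionSolubilityProofs
import HarnessLib

/-!
# A `p`-torsion point on an ADDITIVE fibre at `p ∈ {5, 7}` pins the RESIDUE of `c₄/5` resp.
# `c₆/7`: `c₄ ≡ −5 (mod 25)` at `5`, `c₆ ≡ 7 (mod 49)` at `7` (local theorems over `ℚ_p`)

HONEST FRAMING (cell `b2b-bsdres`, run/shared/lean/b2b/bsd-rank1-residual/, verbatim in every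
file): the goal of the cell is to DELETE the COMBINATION-SHAPED residual classes of the
Birch–Swinnerton-Dyer formula for ALL analytic-rank `≤ 1` elliptic curves over `ℚ` — "full BSD
formula for every rank `≤ 1` curve in class `C`" assembled STRICTLY from published theorems — so
that the rank-`≤ 1` remainder becomes exactly the CONSTRUCTION-SHAPED classes, which are TYPED
(missing-input `Prop`s), NOT attempted. This is not "finishing BSD". Sub-cell `additive-p2`
(X3♯(G-ord) / X4♯(G-ord)), generation 38: research route; no claim beyond the stated classes;
TOOL theorems on local points only, no definition, no named fact, nothing booked, no label moved.

## What and why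

Generation 37 (`Additive/LocalTorsionAdditiveFiveSeven`) proved: over `ℚ_p`, `p ≥ 5`, an
elliptic curve with ADDITIVE minimal reduction and a `ℚ_p`-point `P ≠ O` with `p • P = O` has
`(p = 5 ∧ ‖c₄‖ = 5⁻¹) ∨ (p = 7 ∧ ‖c₆‖ = 7⁻¹)` — the VALUATION of `c₄` / `c₆` is pinned (Kodaira
II/III at `5`, II at `7`).  This file pins the RESIDUE as well:

* **`norm_c₄_add_or_norm_c₆_sub_of_prime_zsmul_eq_zero`** — under the same hypotheses,
  `(p = 5 ∧ ‖c₄ + 5‖ ≤ 5⁻²) ∨ (p = 7 ∧ ‖c₆ − 7‖ ≤ 7⁻²)`, i.e. **`c₄ ≡ −5 (mod 25)`** at `5` and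
  **`c₆ ≡ 7 (mod 49)`** at `7` (both invariant under `u ∈ ℤ_p^×`: `u⁴ ≡ 1 (5)`, `u⁶ ≡ 1 (7)`).

Why this is the point of generation 38: on the cell's (G)-locus (`e ∣ p − 1`) the exceptional
types are III at `5` (`e = 4`) and II at `7` (`e = 6`), and there generation 36
(`Additive/GordAnomalousResidueFour/ThreeSix`) DECIDED Delbourgo's `ReductionNonAnomalous W p` by
ONE residue: anomalous at `5` ⟺ `c₄/(−5)^{v₅(c₄)} ≡ 1 (mod 5)`, anomalous at `7` ⟺
`c₆/(−7)^{v₇(c₆)} ≡ −1 (mod 7)`.  With `v = 1` these are exactly `c₄ ≡ −5 (mod 25)` and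
`c₆ ≡ 7 (mod 49)`: **a rational `p`-torsion point forces the reduction over the (G)-field to be
ANOMALOUS** — the `ℚ`-curve and cell statements are drawn in `Additive/GordTorsionAnomalous`,
the isogeny-class form in `Additive/GordTorsionAnomalousClass`.

Mechanism (elementary, extending Mazur's Step 1 at `q = N` one order deeper): on the short
minimal model `y² = x³ + ax + b` (`a, b ∈ pℤ_p`) a `p`-torsion point `P ≠ O` has UNIT abscissa
`x₀` (`norm_x_eq_one_of_prime_zsmul_eq_zero`: non-integral abscissa is excluded by `E₁(ℚ_p)[p] = 0`,
the cusp by Kodaira–Néron `[E : E₀] ≤ 4` — generation 37's trichotomy); then `ψ_p(x₀) = 0`, and the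
`840`-free SECOND-order cusp jets (`Additive/CuspDivisionPolynomialSecondOrder`)
`ψ₅ ≡ 5x¹² + 62ax¹⁰ + 380bx⁹`, `ψ₇ ≡ 7x²⁴ + 308ax²² + 3944bx²¹ (mod (a, b)² ⊆ (p²))` give
`5x₀² + 62a ∈ (25)` resp. `7x₀³ + 3944b ∈ (49)`; finally the ORDINATE enters: `y₀² ≡ x₀³ (mod p)`
makes `x₀` a square mod `p`, so `x₀² ≡ 1 (mod 5)` resp. `x₀³ ≡ 1 (mod 7)` (`decide` in `ZMod p`),
whence `62·(a/5) ≡ −1 (mod 5)`, `3944·(b/7) ≡ −1 (mod 7)`, i.e. `a ≡ 10 (mod 25)`, `b ≡ 14 (mod 49)`,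
i.e. `c₄ = −48a ≡ −5 (mod 25)`, `c₆ = −864b ≡ 7 (mod 49)` (the other square class of `x₀` would
give the conjugate residues `c₄/(−5) ≡ 4`, `c₆/(−7) ≡ 1`, i.e. `a_w ≡ −1`).

References: [Mazur1977] B. Mazur, Publ. Math. IHÉS 47 (1977), Ch. III §5, Step 1, p. 158 (the
method at `q = N`). [SilvermanAEC2009] VII.3.1, VII.5.1, Exercise 3.7; [SilvermanATAEC1994]
Cor. IV.9.2(d). [Delbourgo2002] D. Delbourgo, JNT 95 (2002), p. 39 (`ℓ_p(E)`) — context.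
-/

noncomputable section

open scoped Classical

namespace Summit.BirchSwinnertonDyer.Rank1Residual.Additive.CuspTorsion

open WeierstrassCurve Polynomial Literature.NumberTheory.EllipticCurves
  Literature.NumberTheory.EllipticCurves.CuspJets

variable {p : ℕ} [Fact p.Prime]

/-! ## §1 The square class of the abscissa: `y² ≡ x³ (mod p)` -/

/-- In `𝔽₅`: `x ≠ 0`, `y² = x³` ⟹ `x² = 1` (`x = (y/x)²` is a square, squares of units have
square `1`). [folklore] -/
theorem zmod_five_sq_eq_one_of_sq_eq_cube :
    ∀ x y : ZMod 5, x ≠ 0 → y ^ 2 = x ^ 3 → x ^ 2 = 1 := by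
  decide

/-- In `𝔽₇`: `x ≠ 0`, `y² = x³` ⟹ `x³ = 1` (`x` is a square, so `x³ = x^{(7−1)/2} = 1`). [folklore] -/
theorem zmod_seven_cube_eq_one_of_sq_eq_cube :
    ∀ x y : ZMod 7, x ≠ 0 → y ^ 2 = x ^ 3 → x ^ 3 = 1 := by
  decide

/-- The integral equation of an integral point on `y² = x³ + ax + b` over `ℤ_p`. [folklore] -/
theorem shortCurve_equation_of_nonsingular {A B x₀ y₀ : ℤ_[p]}
    (h : ((shortCurve A B).baseChange ℚ_[p]).toAffine.Nonsingular
      (algebraMap ℤ_[p] ℚ_[p] x₀) (algebraMap ℤ_[p] ℚ_[p] y₀)) :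
    y₀ ^ 2 = x₀ ^ 3 + A * x₀ + B := by
  have h1 : algebraMap ℤ_[p] ℚ_[p] y₀ ^ 2 +
      algebraMap ℤ_[p] ℚ_[p] 0 * algebraMap ℤ_[p] ℚ_[p] x₀ * algebraMap ℤ_[p] ℚ_[p] y₀ +
      algebraMap ℤ_[p] ℚ_[p] 0 * algebraMap ℤ_[p] ℚ_[p] y₀ =
      algebraMap ℤ_[p] ℚ_[p] x₀ ^ 3 + algebraMap ℤ_[p] ℚ_[p] 0 * algebraMap ℤ_[p] ℚ_[p] x₀ ^ 2 +
      algebraMap ℤ_[p] ℚ_[p] A * algebraMap ℤ_[p] ℚ_[p] x₀ + algebraMap ℤ_[p] ℚ_[p] B :=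
    (Affine.equation_iff _ _).mp h.1
  apply IsFractionRing.injective ℤ_[p] ℚ_[p]
  simp only [map_pow, map_add, map_mul]
  simp only [map_zero, zero_mul, add_zero] at h1
  exact h1

/-- **`p = 5`: a unit-abscissa point on `y² = x³ + ax + b` (`a, b ∈ 5ℤ₅`) has `x₀² ≡ 1 (mod 5)`.**
[folklore] -/
theorem five_dvd_sq_sub_one (hp : p = 5) {A B x₀ y₀ : ℤ_[p]} (hA : (p : ℤ_[p]) ∣ A)
    (hB : (p : ℤ_[p]) ∣ B) (hx : ‖x₀‖ = 1) (heq : y₀ ^ 2 = x₀ ^ 3 + A * x₀ + B) :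
    (p : ℤ_[p]) ∣ x₀ ^ 2 - 1 := by
  subst hp
  have hx0 : PadicInt.toZMod x₀ ≠ 0 := by
    rw [Ne, BinaryQuartic.toZMod_eq_zero_iff, ← PadicInt.norm_lt_one_iff_dvd, hx]; exact lt_irrefl _
  have hA0 : PadicInt.toZMod A = 0 := (BinaryQuartic.toZMod_eq_zero_iff A).mpr hA
  have hB0 : PadicInt.toZMod B = 0 := (BinaryQuartic.toZMod_eq_zero_iff B).mpr hB
  have h' : PadicInt.toZMod y₀ ^ 2 = PadicInt.toZMod x₀ ^ 3 := by
    have := congrArg PadicInt.toZMod heq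
    simpa [map_pow, map_add, map_mul, hA0, hB0] using this
  have key := zmod_five_sq_eq_one_of_sq_eq_cube _ _ hx0 h'
  rw [← BinaryQuartic.toZMod_eq_zero_iff, map_sub, map_pow, map_one, key, sub_self]

/-- **`p = 7`: a unit-abscissa point on `y² = x³ + ax + b` (`a, b ∈ 7ℤ₇`) has `x₀³ ≡ 1 (mod 7)`.**
[folklore] -/
theorem seven_dvd_cube_sub_one (hp : p = 7) {A B x₀ y₀ : ℤ_[p]} (hA : (p : ℤ_[p]) ∣ A)
    (hB : (p : ℤ_[p]) ∣ B) (hx : ‖x₀‖ = 1) (heq : y₀ ^ 2 = x₀ ^ 3 + A * x₀ + B) :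
    (p : ℤ_[p]) ∣ x₀ ^ 3 - 1 := by
  subst hp
  have hx0 : PadicInt.toZMod x₀ ≠ 0 := by
    rw [Ne, BinaryQuartic.toZMod_eq_zero_iff, ← PadicInt.norm_lt_one_iff_dvd, hx]; exact lt_irrefl _
  have hA0 : PadicInt.toZMod A = 0 := (BinaryQuartic.toZMod_eq_zero_iff A).mpr hA
  have hB0 : PadicInt.toZMod B = 0 := (BinaryQuartic.toZMod_eq_zero_iff B).mpr hB
  have h' : PadicInt.toZMod y₀ ^ 2 = PadicInt.toZMod x₀ ^ 3 := by
    have := congrArg PadicInt.toZMod heq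
    simpa [map_pow, map_add, map_mul, hA0, hB0] using this
  have key := zmod_seven_cube_eq_one_of_sq_eq_cube _ _ hx0 h'
  rw [← BinaryQuartic.toZMod_eq_zero_iff, map_sub, map_pow, map_one, key, sub_self]

/-- If `p·u ∈ (p²)` in `ℤ_p` then `p ∣ u`. [folklore] -/
theorem dvd_of_prime_mul_mem_span_sq {u : ℤ_[p]}
    (hu : (p : ℤ_[p]) * u ∈ Ideal.span ({(p : ℤ_[p]) ^ 2} : Set ℤ_[p])) : (p : ℤ_[p]) ∣ u :=
  (PadicInt.norm_lt_one_iff_dvd u).mp (norm_lt_one_of_prime_mul_mem_span_sq hu)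

/-- A unit factor can be cancelled from membership in an ideal of `ℤ_p`. [folklore] -/
theorem mem_of_norm_eq_one_mul_mem {x₀ z : ℤ_[p]} (hx : ‖x₀‖ = 1) (n : ℕ) {I : Ideal ℤ_[p]}
    (h : x₀ ^ n * z ∈ I) : z ∈ I :=
  (Ideal.unit_mul_mem_iff_mem I ((PadicInt.isUnit_iff.mpr hx).pow n)).mp h

/-! ## §3 A `p`-torsion point on the short additive minimal model has UNIT abscissa -/

/-- **Unit abscissa.** On a minimal short equation `y² = x³ + ax + b` over `ℚ_p` (`p ≥ 5`,
`a, b ∈ pℤ_p`), a point `P = (x, y) ≠ O` with `p • P = O` has `‖x‖ = 1`: `‖x‖ > 1` is excluded by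
`E₁(ℚ_p)[p] = 0` (tree), and `‖x‖ < 1` puts `P̄` at the cusp of `ȳ² = x̄³`, outside `E₀`, where
`p • P = O` would force split multiplicative reduction by Kodaira–Néron (`[E : E₀] ≤ 4 < p`).
[cite: Mazur1977, Ch. III §5, Step 1, p. 158; SilvermanATAEC1994, Cor. IV.9.2(d) (PDF p. 340)] -/
theorem norm_x_eq_one_of_prime_zsmul_eq_zero (hp5 : 5 ≤ p) {A B : ℤ_[p]} (hA : ‖A‖ < 1)
    (hB : ‖B‖ < 1) (V : WeierstrassCurve ℚ_[p])
    (hV : V = (shortCurve A B).baseChange ℚ_[p]) [V.IsElliptic] [V.IsMinimal ℤ_[p]]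
    {x y : ℚ_[p]} {h : V.toAffine.Nonsingular x y}
    (hkill : (p : ℤ) • (Affine.Point.some x y h : V.toAffine.Point) = 0) : ‖x‖ = 1 := by
  subst hV
  have hP' : p.Prime := Fact.out
  by_contra hx1
  rcases (Ne.lt_or_gt hx1) with hlt | hgt
  swap
  · exact not_prime_zsmul_eq_zero_of_one_lt_norm (by omega) (shortCurve A B) h hgt hkill
  have hxle : ‖x‖ ≤ 1 := hlt.le
  have hy : ‖y‖ ≤ 1 := norm_y_le_one' (shortCurve A B) h.1 hxle
  obtain ⟨x₀, rfl⟩ : ∃ x₀ : ℤ_[p], algebraMap ℤ_[p] ℚ_[p] x₀ = x := ⟨⟨x, hxle⟩, rfl⟩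
  obtain ⟨y₀, rfl⟩ : ∃ y₀ : ℤ_[p], algebraMap ℤ_[p] ℚ_[p] y₀ = y := ⟨⟨y, hy⟩, rfl⟩
  have hx0 : ‖x₀‖ < 1 := hlt
  have heq : y₀ ^ 2 = x₀ ^ 3 + A * x₀ + B := shortCurve_equation_of_nonsingular h
  have hy0 : ‖y₀‖ < 1 := by
    have h1 : ‖y₀ ^ 2‖ < 1 := by
      rw [heq]
      refine (PadicInt.nonarchimedean _ _).trans_lt (max_lt ((PadicInt.nonarchimedean _ _).trans_lt
        (max_lt ?_ ?_)) hB)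
      · rw [norm_pow]; exact pow_lt_one₀ (norm_nonneg _) hx0 three_ne_zero
      · rw [norm_mul]; exact mul_lt_one_of_nonneg_of_lt_one_left (norm_nonneg _) hA
          (PadicInt.norm_le_one _)
    rw [norm_pow] at h1
    by_contra hy1
    rw [le_antisymm (PadicInt.norm_le_one _) (not_lt.mp hy1), one_pow] at h1
    exact lt_irrefl _ h1
  -- `P ∉ E₀`: it reduces to the cusp `(0, 0)` of `ȳ² = x̄³`
  have hv := integers_valuationRing_valuation ℤ_[p] ℚ_[p]
  have hnotin : (Affine.Point.some _ _ h : ((shortCurve A B).baseChange ℚ_[p]).toAffine.Point) ∉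
      ((shortCurve A B).baseChange ℚ_[p]).goodReductionSubgroup ℤ_[p] := by
    rw [goodReductionSubgroup_baseChange_eq, mem_nonsingularReductionSubgroup_iff,
      hasNonsingularReduction_some_algebraMap_iff hv.hom_inj,
      (IsLocalRing.residue_eq_zero_iff _).mpr (PadicInt.mem_nonunits.mpr hx0),
      (IsLocalRing.residue_eq_zero_iff _).mpr (PadicInt.mem_nonunits.mpr hy0),
      Affine.nonsingular_zero]
    rintro ⟨-, h3 | h4⟩
    · exact h3 (map_zero (IsLocalRing.residue ℤ_[p]))
    · exact h4 ((IsLocalRing.residue_eq_zero_iff A).mpr (PadicInt.mem_nonunits.mpr hA))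
  haveI : Finite (IsLocalRing.ResidueField ℤ_[p]) :=
    Finite.of_equiv (ZMod p) (PadicInt.residueField (p := p)).symm.toEquiv
  haveI : PerfectField (IsLocalRing.ResidueField ℤ_[p]) := PerfectField.ofFinite
  obtain ⟨hsplit, -⟩ := hasSplitMultiplicativeReduction_of_not_mem_goodReductionSubgroup ℤ_[p]
    ((shortCurve A B).baseChange ℚ_[p]) hP' (by omega)
    (P := Affine.Point.some _ _ h) (by rw [← natCast_zsmul]; exact hkill) hnotin
  have hmult := hsplit.toHasMultiplicativeReduction.multiplicativeReduction
  have ec : ((shortCurve A B).baseChange ℚ_[p]).c₄ =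
      algebraMap ℤ_[p] ℚ_[p] (shortCurve A B).c₄ :=
    map_c₄ (shortCurve A B) (algebraMap ℤ_[p] ℚ_[p])
  rw [ec, (shortCurve_c₄_Δ A B).1,
    IsDedekindDomain.HeightOneSpectrum.valuation_eq_one_iff_notMem] at hmult
  refine hmult (PadicInt.mem_nonunits.mpr ?_)
  rw [show (-48 : ℤ_[p]) * A = -(48 * A) by ring, norm_neg, norm_mul]
  exact mul_lt_one_of_nonneg_of_lt_one_right (PadicInt.norm_le_one _) (norm_nonneg _) hA

/-! ## §4 The residue at `p = 5` and at `p = 7` (short model, unit abscissa) -/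

/-- **`p = 5`: a `5`-torsion point with unit abscissa on `y² = x³ + ax + b` (`a, b ∈ 5ℤ₅`) forces
`25 ∣ c₄ + 5`** (`c₄ = −48a`; i.e. `a ≡ 10 (mod 25)`): `ψ₅(x₀) = 0` with
`ψ₅ ≡ 5x¹² + 62ax¹⁰ + 380bx⁹ (mod (a,b)² ⊆ (25))` gives `5x₀² + 62a ∈ (25)`, and `x₀² ≡ 1 (mod 5)`
gives `1 + 62(a/5) ∈ (5)`. [cite: Mazur1977, Ch. III §5, Step 1, p. 158; SilvermanAEC2009, Exercise 3.7(d),(f) (PDF pp. 97–98)] -/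
theorem sq_dvd_c₄_add_of_prime_zsmul_eq_zero_five (hp : p = 5) {A B : ℤ_[p]}
    (hA : (p : ℤ_[p]) ∣ A) (hB : (p : ℤ_[p]) ∣ B)
    [((shortCurve A B).baseChange ℚ_[p]).IsElliptic] {x₀ y₀ : ℤ_[p]} (hx : ‖x₀‖ = 1)
    (h : ((shortCurve A B).baseChange ℚ_[p]).toAffine.Nonsingular
      (algebraMap ℤ_[p] ℚ_[p] x₀) (algebraMap ℤ_[p] ℚ_[p] y₀))
    (h0 : (p : ℤ) • (Affine.Point.some _ _ h :
      ((shortCurve A B).baseChange ℚ_[p]).toAffine.Point) = 0) :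
    (p : ℤ_[p]) ^ 2 ∣ (shortCurve A B).c₄ + p := by
  have h1 := eval_preΨ'_eq_zero_of_prime_zsmul_eq_zero (by omega) h h0
  have hres := five_dvd_sq_sub_one hp hA hB hx (shortCurve_equation_of_nonsingular h)
  have key := (eval_preΨ'_sub_cuspLinear_mem_span_sq hA hB x₀).1
  subst hp
  rw [h1, zero_sub, neg_mem_iff] at key
  obtain ⟨A', rfl⟩ := hA
  obtain ⟨B', rfl⟩ := hB
  obtain ⟨t, ht⟩ := hres
  -- `5x₀¹² + 62·a·x₀¹⁰ ∈ (25)` (the `380 b` term is in `(25)`)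
  have hmem : x₀ ^ 10 * (((5 : ℕ) : ℤ_[5]) * (x₀ ^ 2 + 62 * A')) ∈
      Ideal.span ({((5 : ℕ) : ℤ_[5]) ^ 2} : Set ℤ_[5]) := by
    have e : x₀ ^ 10 * (((5 : ℕ) : ℤ_[5]) * (x₀ ^ 2 + 62 * A')) =
        (5 * x₀ ^ 12 + 62 * (((5 : ℕ) : ℤ_[5]) * A') * x₀ ^ 10 +
            380 * (((5 : ℕ) : ℤ_[5]) * B') * x₀ ^ 9) -
          ((5 : ℕ) : ℤ_[5]) ^ 2 * (76 * B' * x₀ ^ 9) := by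
      push_cast; ring
    rw [e]
    exact sub_mem key (Ideal.mem_span_singleton.mpr (dvd_mul_right _ _))
  have h2 : ((5 : ℕ) : ℤ_[5]) ∣ x₀ ^ 2 + 62 * A' :=
    dvd_of_prime_mul_mem_span_sq (mem_of_norm_eq_one_mul_mem hx 10 hmem)
  -- with `x₀² = 1 + 5t`: `5 ∣ 1 + 62 A'`
  obtain ⟨n, hn⟩ : ((5 : ℕ) : ℤ_[5]) ∣ 1 + 62 * A' := by
    have e : 1 + 62 * A' = (x₀ ^ 2 + 62 * A') - (x₀ ^ 2 - 1) := by ring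
    rw [e]; exact dvd_sub h2 ⟨t, ht⟩
  refine ⟨1 + 40 * A' - 4 * n, ?_⟩
  rw [(shortCurve_c₄_Δ _ _).1]
  push_cast at hn ⊢
  linear_combination (-20 : ℤ_[5]) * hn

/-- **`p = 7`: a `7`-torsion point with unit abscissa on `y² = x³ + ax + b` (`a, b ∈ 7ℤ₇`) forces
`49 ∣ c₆ − 7`** (`c₆ = −864b`; i.e. `b ≡ 14 (mod 49)`): `ψ₇(x₀) = 0` with
`ψ₇ ≡ 7x²⁴ + 308ax²² + 3944bx²¹ (mod (a,b)² ⊆ (49))`, `7 ∣ 308`, gives `7x₀³ + 3944b ∈ (49)`, and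
`x₀³ ≡ 1 (mod 7)` gives `1 + 3944(b/7) ∈ (7)`. [cite: Mazur1977, Ch. III §5, Step 1, p. 158; SilvermanAEC2009, Exercise 3.7(d),(f) (PDF pp. 97–98)] -/
theorem sq_dvd_c₆_sub_of_prime_zsmul_eq_zero_seven (hp : p = 7) {A B : ℤ_[p]}
    (hA : (p : ℤ_[p]) ∣ A) (hB : (p : ℤ_[p]) ∣ B)
    [((shortCurve A B).baseChange ℚ_[p]).IsElliptic] {x₀ y₀ : ℤ_[p]} (hx : ‖x₀‖ = 1)
    (h : ((shortCurve A B).baseChange ℚ_[p]).toAffine.Nonsingular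
      (algebraMap ℤ_[p] ℚ_[p] x₀) (algebraMap ℤ_[p] ℚ_[p] y₀))
    (h0 : (p : ℤ) • (Affine.Point.some _ _ h :
      ((shortCurve A B).baseChange ℚ_[p]).toAffine.Point) = 0) :
    (p : ℤ_[p]) ^ 2 ∣ (shortCurve A B).c₆ - p := by
  have h1 := eval_preΨ'_eq_zero_of_prime_zsmul_eq_zero (by omega) h h0
  have hres := seven_dvd_cube_sub_one hp hA hB hx (shortCurve_equation_of_nonsingular h)
  have key := (eval_preΨ'_sub_cuspLinear_mem_span_sq hA hB x₀).2
  subst hp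
  rw [h1, zero_sub, neg_mem_iff] at key
  obtain ⟨A', rfl⟩ := hA
  obtain ⟨B', rfl⟩ := hB
  obtain ⟨t, ht⟩ := hres
  -- `7x₀²⁴ + 3944·b·x₀²¹ ∈ (49)` (the `308 a` term is in `(49)`)
  have hmem : x₀ ^ 21 * (((7 : ℕ) : ℤ_[7]) * (x₀ ^ 3 + 3944 * B')) ∈
      Ideal.span ({((7 : ℕ) : ℤ_[7]) ^ 2} : Set ℤ_[7]) := by
    have e : x₀ ^ 21 * (((7 : ℕ) : ℤ_[7]) * (x₀ ^ 3 + 3944 * B')) =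
        (7 * x₀ ^ 24 + 308 * (((7 : ℕ) : ℤ_[7]) * A') * x₀ ^ 22 +
            3944 * (((7 : ℕ) : ℤ_[7]) * B') * x₀ ^ 21) -
          ((7 : ℕ) : ℤ_[7]) ^ 2 * (44 * A' * x₀ ^ 22) := by
      push_cast; ring
    rw [e]
    exact sub_mem key (Ideal.mem_span_singleton.mpr (dvd_mul_right _ _))
  have h2 : ((7 : ℕ) : ℤ_[7]) ∣ x₀ ^ 3 + 3944 * B' :=
    dvd_of_prime_mul_mem_span_sq (mem_of_norm_eq_one_mul_mem hx 21 hmem)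
  obtain ⟨n, hn⟩ : ((7 : ℕ) : ℤ_[7]) ∣ 1 + 3944 * B' := by
    have e : 1 + 3944 * B' = (x₀ ^ 3 + 3944 * B') - (x₀ ^ 3 - 1) := by ring
    rw [e]; exact dvd_sub h2 ⟨t, ht⟩
  refine ⟨440 * B' - n, ?_⟩
  rw [shortCurve_c₆]
  push_cast at hn ⊢
  linear_combination (-7 : ℤ_[7]) * hn

/-! ## §5 The short minimal model: the residue disjunction -/

/-- **Short minimal model, every `p ≥ 5`**: `y² = x³ + ax + b` over `ℚ_p` with `a, b ∈ pℤ_p`,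
minimal, `P ≠ O`, `p • P = O` ⟹ **`(p = 5 ∧ 25 ∣ c₄ + 5) ∨ (p = 7 ∧ 49 ∣ c₆ − 7)`** (at
`p ≥ 11` there is no such `P`: the tree's Mazur Step 1).
[cite: Mazur1977, Ch. III §5, Step 1, p. 158] -/
theorem sq_dvd_c₄_add_or_c₆_sub_of_prime_zsmul_eq_zero_short (hp5 : 5 ≤ p) {A B : ℤ_[p]}
    (hA : ‖A‖ < 1) (hB : ‖B‖ < 1) (V : WeierstrassCurve ℚ_[p])
    (hV : V = (shortCurve A B).baseChange ℚ_[p]) [V.IsElliptic] [V.IsMinimal ℤ_[p]]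
    {P : V.toAffine.Point} (hP0 : P ≠ 0) (hP : (p : ℤ) • P = 0) :
    (p = 5 ∧ (p : ℤ_[p]) ^ 2 ∣ (shortCurve A B).c₄ + p) ∨
      (p = 7 ∧ (p : ℤ_[p]) ^ 2 ∣ (shortCurve A B).c₆ - p) := by
  rcases eq_five_or_eq_seven_or_eleven_le hp5 with hp | hp | h11
  rotate_right
  · exact absurd hP (not_prime_zsmul_eq_zero_of_short h11 hA hB V hV hP0)
  all_goals
    rcases P with _ | ⟨x, y, h⟩
    · exact absurd rfl hP0
    have hx1 := norm_x_eq_one_of_prime_zsmul_eq_zero hp5 hA hB V hV hP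
    subst hV
    have hy : ‖y‖ ≤ 1 := norm_y_le_one' (shortCurve A B) h.1 hx1.le
    obtain ⟨x₀, rfl⟩ : ∃ x₀ : ℤ_[p], algebraMap ℤ_[p] ℚ_[p] x₀ = x := ⟨⟨x, hx1.le⟩, rfl⟩
    obtain ⟨y₀, rfl⟩ : ∃ y₀ : ℤ_[p], algebraMap ℤ_[p] ℚ_[p] y₀ = y := ⟨⟨y, hy⟩, rfl⟩
    have hx1' : ‖x₀‖ = 1 := hx1
    have hA' := (PadicInt.norm_lt_one_iff_dvd A).mp hA
    have hB' := (PadicInt.norm_lt_one_iff_dvd B).mp hB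
    first
      | exact Or.inl ⟨hp, sq_dvd_c₄_add_of_prime_zsmul_eq_zero_five hp hA' hB' hx1' h hP⟩
      | exact Or.inr ⟨hp, sq_dvd_c₆_sub_of_prime_zsmul_eq_zero_seven hp hA' hB' hx1' h hP⟩

/-! ## §6 Arbitrary additive minimal model over `ℚ_p` -/

/-- In `ℤ_p`: `p² ∣ z ⟹ ‖z‖ ≤ p⁻²` (read in `ℚ_p`). [folklore] -/
theorem norm_le_of_sq_dvd {z : ℤ_[p]} (hz : (p : ℤ_[p]) ^ 2 ∣ z) :
    ‖algebraMap ℤ_[p] ℚ_[p] z‖ ≤ (p : ℝ) ^ (-2 : ℤ) := by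
  have h := (PadicInt.norm_le_pow_iff_mem_span_pow z 2).mpr (Ideal.mem_span_singleton.mpr hz)
  exact h

/-- **The residue of `c₄/5`, `c₆/7` forced by a `p`-torsion point — arbitrary model.** Over `ℚ_p`,
`p ≥ 5`, an elliptic curve whose minimal model has ADDITIVE reduction and a `ℚ_p`-point `P ≠ O`
with `p • P = O` satisfies **`(p = 5 ∧ ‖c₄ + 5‖ ≤ 5⁻²) ∨ (p = 7 ∧ ‖c₆ − 7‖ ≤ 7⁻²)`**, i.e.
`c₄ ≡ −5 (mod 25)` (so `v₅(c₄) = 1` AND `c₄/(−5) ≡ 1 (mod 5)`) resp. `c₆ ≡ 7 (mod 49)` (`v₇(c₆) = 1`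
AND `c₆/(−7) ≡ −1 (mod 7)`). The minimal integral model is brought to short form by Mathlib's
`toShortNF` (`u = 1`: same `c₄`, `c₆`, still minimal). Sharp: `y² − 2xy − 3y = x³ − 3x²`
(`X₁(5)`, `c₄ = −80 ≡ 20 (mod 25)`), `[−19,−100,−100,0,0]` (`X₁(7)`, `c₆ = −7·681183 ≡ 7 (mod 49)`).
[cite: Mazur1977, Ch. III §5, Step 1, p. 158] -/
theorem norm_c₄_add_or_norm_c₆_sub_of_prime_zsmul_eq_zero (hp5 : 5 ≤ p)
    (W : WeierstrassCurve ℚ_[p]) [W.IsElliptic] [hadd : W.HasAdditiveReduction ℤ_[p]]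
    {P : W.toAffine.Point} (hP0 : P ≠ 0) (hP : (p : ℤ) • P = 0) :
    (p = 5 ∧ ‖W.c₄ + p‖ ≤ (p : ℝ) ^ (-2 : ℤ)) ∨ (p = 7 ∧ ‖W.c₆ - p‖ ≤ (p : ℝ) ^ (-2 : ℤ)) := by
  obtain ⟨h2, h3⟩ := norm_two_three (p := p) hp5
  haveI : Invertible (2 : ℤ_[p]) := (PadicInt.isUnit_iff.mpr h2).invertible
  haveI : Invertible (3 : ℤ_[p]) := (PadicInt.isUnit_iff.mpr h3).invertible
  have hc₄ := hadd.additiveReduction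
  have hΔ := hadd.badReduction
  obtain ⟨W₀, hW₀⟩ : ∃ W₀ : WeierstrassCurve ℤ_[p], W = W₀.baseChange ℚ_[p] :=
    IsIntegral.integral
  subst hW₀
  set D : VariableChange ℤ_[p] := W₀.toShortNF with hD
  have hDu : D.u = 1 := toShortNF_u W₀
  haveI hNF : (D • W₀).IsShortNF := WeierstrassCurve.toShortNF_spec W₀
  set A := (D • W₀).a₄ with hA'
  set B := (D • W₀).a₆ with hB'
  have hM : D • W₀ = shortCurve A B :=
    WeierstrassCurve.ext hNF.a₁ hNF.a₂ hNF.a₃ rfl rfl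
  have ec₄ : (shortCurve A B).c₄ = W₀.c₄ := by
    rw [← hM, variableChange_c₄, hDu, inv_one, Units.val_one, one_pow, one_mul]
  have ec₆ : (shortCurve A B).c₆ = W₀.c₆ := by
    rw [← hM, variableChange_c₆, hDu, inv_one, Units.val_one, one_pow, one_mul]
  have hn : ∀ z : ℤ_[p], ‖algebraMap ℤ_[p] ℚ_[p] z‖ = ‖z‖ := fun z => rfl
  have ec : (W₀.baseChange ℚ_[p]).c₄ = algebraMap ℤ_[p] ℚ_[p] W₀.c₄ :=
    map_c₄ W₀ (algebraMap ℤ_[p] ℚ_[p])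
  have ec' : (W₀.baseChange ℚ_[p]).c₆ = algebraMap ℤ_[p] ℚ_[p] W₀.c₆ :=
    map_c₆ W₀ (algebraMap ℤ_[p] ℚ_[p])
  have hc₄' : ‖(shortCurve A B).c₄‖ < 1 := by
    rw [ec₄]
    rw [ec, IsDedekindDomain.HeightOneSpectrum.valuation_lt_one_iff_mem] at hc₄
    exact PadicInt.mem_nonunits.mp hc₄
  have hΔ' : ‖(shortCurve A B).Δ‖ < 1 := by
    rw [← hM, variableChange_Δ, hDu, inv_one, Units.val_one, one_pow, one_mul]
    have eΔ : (W₀.baseChange ℚ_[p]).Δ = algebraMap ℤ_[p] ℚ_[p] W₀.Δ :=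
      map_Δ W₀ (algebraMap ℤ_[p] ℚ_[p])
    rw [eΔ, IsDedekindDomain.HeightOneSpectrum.valuation_lt_one_iff_mem] at hΔ
    exact PadicInt.mem_nonunits.mp hΔ
  obtain ⟨hA, hB⟩ := norm_lt_one_of_short (p := p) hp5 hc₄' hΔ'
  -- the short model over `ℚ_p` and the transported point
  have hV : D.baseChange ℚ_[p] • W₀.baseChange ℚ_[p] = (shortCurve A B).baseChange ℚ_[p] := by
    rw [← hM]
    exact map_variableChange W₀ D (algebraMap ℤ_[p] ℚ_[p])
  haveI : (D.baseChange ℚ_[p] • W₀.baseChange ℚ_[p]).IsMinimal ℤ_[p] :=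
    IsMinimal.smul_baseChange (W₀.baseChange ℚ_[p]) D
  set e := VariableChange.pointEquiv (W₀.baseChange ℚ_[p]) (D.baseChange ℚ_[p])
  have hP1 : e P ≠ 0 := fun h0 => hP0 (e.injective (h0.trans e.map_zero.symm))
  have hP2 : (p : ℤ) • e P = 0 := by rw [← map_zsmul e, hP, map_zero]
  rcases sq_dvd_c₄_add_or_c₆_sub_of_prime_zsmul_eq_zero_short hp5 hA hB _ hV hP1 hP2 with
    ⟨hp, hdvd⟩ | ⟨hp, hdvd⟩
  · refine Or.inl ⟨hp, ?_⟩
    rw [ec, show algebraMap ℤ_[p] ℚ_[p] W₀.c₄ + (p : ℚ_[p]) =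
      algebraMap ℤ_[p] ℚ_[p] (W₀.c₄ + p) by simp, ← ec₄]
    exact norm_le_of_sq_dvd hdvd
  · refine Or.inr ⟨hp, ?_⟩
    rw [ec', show algebraMap ℤ_[p] ℚ_[p] W₀.c₆ - (p : ℚ_[p]) =
      algebraMap ℤ_[p] ℚ_[p] (W₀.c₆ - p) by simp, ← ec₆]
    exact norm_le_of_sq_dvd hdvd

end Summit.BirchSwinnertonDyer.Rank1Residual.Additive.CuspTorsion

end
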